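import Mathlib
import Summits.NavierStokesRegularity.NavierStokesRegularity.Theorems.LevelSetModerationHighSpeedPressureWorkFastSetDuhamelSmall
import Summits.NavierStokesRegularity.NavierStokesRegularity.Theorems.LevelSetModerationHighSpeedPressureWorkEarlyWindow

/-!
# Route LevelSetModeration — `HighSpeedPressureWork`: the log-suppressed overshoot of the speed above its initial maximum

Support file for item stmt-NavierStokesRegularity-18149 (`HighSpeedPressureWork`), stub
`stub_earlyBookkeeping` (margin zero). The overshoot bound of the class
(`exists_norm_le_initial_add_of_speed_le`, p163867: `‖u(t,x)‖ ≤ B₀ + C G²√(t/ν)`) is improved by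
a logarithm at margin zero:

  `sup_x ‖u(t, x)‖ ≤ B₀ + C B₀ √(B₀² t/ν) / √(log(ν/(4 B₀² t)))`   for `0 < t ≤ ε ν/B₀²`

(`levelSetModeration_overshoot_log`; unit form `levelSetModeration_overshoot_log_unit`, scale
invariant form `levelSetModeration_overshoot_log_of_speed_le`). Short-time growth of the `L^∞`
norm of a Navier–Stokes solution from bounded data is `o(√t)`: at a point above the initial
maximum, `‖u(t,x)‖ = ⟪e, e^{(t−t²)Δ}u(t²)⟫(x) − ⟪e, B_{t²}(u,u)(t)⟫(x) ≤ (B₀ + C₃-overshoot by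
time `t²`) + ‖B_{t²}(u,u)(t)(x)‖`, and the Duhamel term at a fast point is log-small
(`levelSetModeration_fastSet_duhamel_small`: its sources are localised away from the point by the
sharp Harnack inequality). Consequence for the early stub: the excess kinetic energy above the
initial maximum level obeys `U_c(t) ≤ ½ C² B₀² (B₀²t/ν) |{|u(t)|>c}| / log(ν/(4B₀²t))`.
-/

noncomputable section

-- single-conjunct summit: `Summit.<Summit>.<Problem>` repeats the name by the D-0017 layout
set_option linter.dupNamespace false

namespace Summit.NavierStokesRegularity.NavierStokesRegularity.Theorems

open MeasureTheory Set Filter Topology Function Metric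
open scoped ENNReal RealInnerProductSpace
open Literature.Analysis.FluidPDE
open Literature.Analysis.UnboundedOperators (heatExtension norm_heatExtension_le_of_bound)

/-- **Log-suppressed overshoot, unit form.** Absolute `C ≥ 0`, `ε > 0` such that every classical
solution (`ν = 1`) on `ℝ³ × [0, b)` with `‖u‖ ≤ 1` on `[0, T] × ℝ³` (`T < b`),
`‖u(t)‖_{L²} ≤ K < ∞` there, and `‖u(0,·)‖ ≤ 1/2` satisfies `‖u(t,x)‖ ≤ 1/2 + C √t/√(log(1/t))`
for all `x` and all `t ∈ (0,T)` with `t ≤ ε`. [folklore] -/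
theorem levelSetModeration_overshoot_log_unit :
    ∃ C ε : ℝ, 0 ≤ C ∧ 0 < ε ∧ ∀ {b T : ℝ} {u : ℝ → EuclideanSpace ℝ (Fin 3) → EuclideanSpace ℝ (Fin 3)} {p : ℝ → EuclideanSpace ℝ (Fin 3) → ℝ}, Literature.Analysis.FluidPDE.IsClassicalNSSolutionOn (Set.Ico 0 b) 1 0 u p → 0 < T → T < b → (∀ t ∈ Set.Icc 0 T, ∀ x, ‖u t x‖ ≤ 1) → ∀ {K : ENNReal}, K ≠ ⊤ → (∀ t ∈ Set.Icc 0 T, MeasureTheory.eLpNorm (u t) 2 MeasureTheory.volume ≤ K) → (∀ x, ‖u 0 x‖ ≤ 1 / 2) → ∀ t ∈ Set.Ioo 0 T, t ≤ ε → ∀ x, ‖u t x‖ ≤ 1 / 2 + C * Real.sqrt t / Real.sqrt (Real.log (1 / t)) := by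
  obtain ⟨C₃, hC₃, hover⟩ := exists_norm_le_initial_add_of_classical_unit
  obtain ⟨c, εs, hc0, hεs, hsmall⟩ := levelSetModeration_fastSet_duhamel_small
  refine ⟨Real.sqrt 2 * C₃ + c, min εs (min (1 / 4) (1 / C₃ ^ 2)), by positivity,
    lt_min hεs (lt_min (by norm_num) (by positivity)), ?_⟩
  intro b T u p hcl hT hTb hbd K hK hL2 hB0 t ht htε x
  have ht0 : 0 < t := ht.1
  have htεs : t ≤ εs := htε.trans (min_le_left _ _)
  have ht14 : t ≤ 1 / 4 := htε.trans ((min_le_right _ _).trans (min_le_left _ _))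
  have ht1 : t ≤ 1 := by linarith
  have hsqt2 : Real.sqrt t ≤ 1 / 2 := by
    rw [show (1 : ℝ) / 2 = Real.sqrt ((1 / 2) ^ 2) by rw [Real.sqrt_sq (by norm_num)]]
    exact Real.sqrt_le_sqrt (by norm_num; linarith)
  have hC₃s : C₃ * Real.sqrt t ≤ 1 := by
    have h1 : t ≤ 1 / C₃ ^ 2 := htε.trans ((min_le_right _ _).trans (min_le_right _ _))
    have h2 : Real.sqrt t ≤ Real.sqrt (1 / C₃ ^ 2) := Real.sqrt_le_sqrt h1
    rw [Real.sqrt_div' _ (sq_nonneg _), Real.sqrt_one, Real.sqrt_sq hC₃.le] at h2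
    calc C₃ * Real.sqrt t ≤ C₃ * (1 / C₃) := mul_le_mul_of_nonneg_left h2 hC₃.le
      _ = 1 := by field_simp
  have hlogt : 0 < Real.log (1 / t) := Real.log_pos (by rw [lt_div_iff₀ ht0]; linarith)
  have hsqlog : 0 < Real.sqrt (Real.log (1 / t)) := Real.sqrt_pos.2 hlogt
  have hsqt : 0 < Real.sqrt t := Real.sqrt_pos.2 ht0
  have hnonneg : 0 ≤ (Real.sqrt 2 * C₃ + c) * Real.sqrt t / Real.sqrt (Real.log (1 / t)) := by positivity
  by_cases hfast : 1 / 2 < ‖u t x‖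
  swap
  · rw [not_lt] at hfast
    linarith
  -- the fast case
  have hs₀ : 0 < t ^ 2 := pow_pos ht0 2
  have hs₀t : t ^ 2 < t := by rw [sq]; exact mul_lt_of_lt_one_left ht0 (by linarith)
  have hs₀T : t ^ 2 < T := hs₀t.trans ht.2
  have hts0 : 0 < t - t ^ 2 := sub_pos.2 hs₀t
  have hcl' : IsClassicalNSSolutionOn (Ioo 0 b) 1 0 u p :=
    hcl.mono Ioo_subset_Ico_self (uniqueDiffOn_Ioo 0 b)
  have hbd' : ∀ τ ∈ Ioc 0 T, ∀ y, ‖u τ y‖ ≤ 1 := fun τ hτ y => hbd τ ⟨hτ.1.le, hτ.2⟩ y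
  have hL2' : ∀ τ ∈ Ioc 0 T, eLpNorm (u τ) 2 volume ≤ K := fun τ hτ => hL2 τ ⟨hτ.1.le, hτ.2⟩
  set Bs : ℝ := 1 / 2 + C₃ * t with hBs
  have hBs12 : 1 / 2 ≤ Bs := by rw [hBs]; linarith [mul_nonneg hC₃.le ht0.le]
  have hC₃t : C₃ * t ≤ 1 / 2 := by
    calc C₃ * t = C₃ * Real.sqrt t * Real.sqrt t := by rw [mul_assoc, Real.mul_self_sqrt ht0.le]
      _ ≤ 1 * Real.sqrt t := mul_le_mul_of_nonneg_right hC₃s hsqt.le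
      _ ≤ 1 / 2 := by rw [one_mul]; exact hsqt2
  have hBs1 : Bs ≤ 1 := by rw [hBs]; linarith
  have hBsC : Bs - 1 / 2 ≤ C₃ * t := by rw [hBs]; linarith
  have hus₀ : ∀ y, ‖u (t ^ 2) y‖ ≤ Bs := by
    intro y
    have := hover hcl hT hTb hbd hK hL2' hB0 (t ^ 2) ⟨hs₀, hs₀T⟩ y
    rwa [sub_zero, Real.sqrt_sq ht0.le] at this
  -- the frozen direction
  have hux : 0 < ‖u t x‖ := lt_trans (by norm_num) hfast
  set e : EuclideanSpace ℝ (Fin 3) := ‖u t x‖⁻¹ • u t x with he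
  have hen : ‖e‖ = 1 := by rw [he, norm_smul, norm_inv, norm_norm, inv_mul_cancel₀ hux.ne']
  have hex : ⟪e, u t x⟫ = ‖u t x‖ := by
    rw [he, real_inner_smul_left, real_inner_self_eq_norm_sq]
    field_simp
  have hex' : 1 / 2 < ⟪e, u t x⟫ := by rw [hex]; exact hfast
  -- the log-small Duhamel term and the mild formula at `(t, x)`
  have hw := hsmall hcl' hT hTb hbd' hK hL2' t ht htεs C₃ Bs hC₃.le hC₃s hBs12 hBs1 hBsC hus₀ x e hen hex'
  have hmild : u t x = heatExtension (u (t ^ 2)) (t - t ^ 2) x - oseenDuhamel 1 (t ^ 2) u u t x :=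
    mild_of_bounded_of_eLpNorm_two_le_of_lt hcl' hT hTb hbd' hK hL2' hs₀ hs₀t ht.2 x
  have hH : ‖heatExtension (u (t ^ 2)) (t - t ^ 2) x‖ ≤ Bs := norm_heatExtension_le_of_bound hus₀ hts0 x
  have h1 : ‖u t x‖ ≤ Bs + c * Real.sqrt t / Real.sqrt (Real.log (1 / t)) := by
    rw [← hex, hmild, inner_sub_right]
    have ha : ⟪e, heatExtension (u (t ^ 2)) (t - t ^ 2) x⟫ ≤ Bs := by
      have := abs_real_inner_le_norm e (heatExtension (u (t ^ 2)) (t - t ^ 2) x)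
      rw [hen, one_mul] at this
      exact ((le_abs_self _).trans this).trans hH
    have hb : -⟪e, oseenDuhamel 1 (t ^ 2) u u t x⟫ ≤ c * Real.sqrt t / Real.sqrt (Real.log (1 / t)) := by
      have := abs_real_inner_le_norm e (oseenDuhamel 1 (t ^ 2) u u t x)
      rw [hen, one_mul] at this
      exact ((neg_le_abs _).trans this).trans hw
    linarith
  -- `C₃ t ≤ √2 C₃ √t / √(log(1/t))`
  have h2 : C₃ * t ≤ Real.sqrt 2 * C₃ * Real.sqrt t / Real.sqrt (Real.log (1 / t)) := by
    have htl : t * Real.sqrt (Real.log (1 / t)) ≤ Real.sqrt 2 * Real.sqrt t :=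
      fastSet_mul_sqrt_le ht0 (by linarith)
    rw [le_div_iff₀ hsqlog]
    calc C₃ * t * Real.sqrt (Real.log (1 / t)) = C₃ * (t * Real.sqrt (Real.log (1 / t))) := by ring
      _ ≤ C₃ * (Real.sqrt 2 * Real.sqrt t) := mul_le_mul_of_nonneg_left htl hC₃.le
      _ = Real.sqrt 2 * C₃ * Real.sqrt t := by ring
  calc ‖u t x‖ ≤ Bs + c * Real.sqrt t / Real.sqrt (Real.log (1 / t)) := h1
    _ = 1 / 2 + C₃ * t + c * Real.sqrt t / Real.sqrt (Real.log (1 / t)) := by rw [hBs]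
    _ ≤ 1 / 2 + Real.sqrt 2 * C₃ * Real.sqrt t / Real.sqrt (Real.log (1 / t)) +
          c * Real.sqrt t / Real.sqrt (Real.log (1 / t)) := by linarith
    _ = 1 / 2 + (Real.sqrt 2 * C₃ + c) * Real.sqrt t / Real.sqrt (Real.log (1 / t)) := by ring

/-- **Log-suppressed overshoot under a speed bound (scale-invariant form).** Absolute `C ≥ 0`,
`ε > 0` such that: for `ν > 0`, `G > 0`, every classical solution with viscosity `ν` on
`ℝ³ × [0, T)` bounded by `G` on `[0, T'] × ℝ³` (`T' < T`), with slices uniformly in `L²` there,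
and with `‖u(0,·)‖ ≤ G/2`, satisfies `‖u(t,x)‖ ≤ G/2 + C G √(G²t/ν)/√(log(ν/(G²t)))` for all `x`
and `t ∈ (0, T')` with `t ≤ εν/G²` (scaling of the unit form). [folklore] -/
theorem levelSetModeration_overshoot_log_of_speed_le :
    ∃ C ε : ℝ, 0 ≤ C ∧ 0 < ε ∧ ∀ {ν T T' G : ℝ}
      {u : ℝ → EuclideanSpace ℝ (Fin 3) → EuclideanSpace ℝ (Fin 3)}
      {p : ℝ → EuclideanSpace ℝ (Fin 3) → ℝ}, 0 < ν → 0 < G →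
      IsClassicalNSSolutionOn (Ico 0 T) ν 0 u p → 0 < T' → T' < T →
      (∀ t ∈ Icc 0 T', ∀ x, ‖u t x‖ ≤ G) → ∀ {K : ℝ≥0∞}, K ≠ ∞ →
      (∀ t ∈ Icc 0 T', eLpNorm (u t) 2 volume ≤ K) → (∀ x, ‖u 0 x‖ ≤ G / 2) →
      ∀ t ∈ Ioo 0 T', t ≤ ε * ν / G ^ 2 → ∀ x,
        ‖u t x‖ ≤ G / 2 + C * G * Real.sqrt (G ^ 2 * t / ν) / Real.sqrt (Real.log (ν / (G ^ 2 * t))) := by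
  obtain ⟨C, ε, hC0, hε, hunit⟩ := levelSetModeration_overshoot_log_unit
  refine ⟨C, ε, hC0, hε, ?_⟩
  intro ν T T' G u p hν hG hcl hT' hT'T hbd K hK hL2 hB0 t ht htε x
  -- scaling parameters
  set α : ℝ := G⁻¹ with hα
  set γ : ℝ := ν / G with hγ
  set β : ℝ := ν / G ^ 2 with hβ
  have hαpos : 0 < α := by rw [hα]; positivity
  have hγpos : 0 < γ := by rw [hγ]; positivity
  have hβpos : 0 < β := by rw [hβ]; positivity
  have hβαγ : β = α * γ := by rw [hβ, hα, hγ]; field_simp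
  have hcl' := hcl.stRescale hαpos hγpos hβαγ 0 0
  have hS : ((fun r => (0 : ℝ) + β * r) ⁻¹' Ico 0 T) = Ico 0 (T / β) := by
    ext r
    simp only [mem_preimage, mem_Ico, zero_add]
    constructor
    · rintro ⟨h1, h2⟩
      exact ⟨nonneg_of_mul_nonneg_right h1 hβpos, (lt_div_iff₀' hβpos).2 h2⟩
    · rintro ⟨h1, h2⟩
      exact ⟨mul_nonneg hβpos.le h1, (lt_div_iff₀' hβpos).1 h2⟩
  have hν1 : α * ν / γ = 1 := by rw [hα, hγ]; field_simp
  rw [hS, hν1, smul_stPull_zero] at hcl'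
  set w : ℝ → EuclideanSpace ℝ (Fin 3) → EuclideanSpace ℝ (Fin 3) := α • stPull β γ 0 0 u with hw
  have hwapp : ∀ s y, w s y = α • u (β * s) (γ • y) := by
    intro s y
    simp only [hw, Pi.smul_apply, stPull_apply, zero_add]
  have hT'β : 0 < T' / β := div_pos hT' hβpos
  have hT'βT : T' / β < T / β := div_lt_div_of_pos_right hT'T hβpos
  have hmemI : ∀ {s : ℝ}, s ∈ Icc 0 (T' / β) → β * s ∈ Icc 0 T' := by
    intro s hs
    refine ⟨mul_nonneg hβpos.le hs.1, ?_⟩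
    have := hs.2
    rwa [le_div_iff₀' hβpos] at this
  have hbd' : ∀ s ∈ Icc 0 (T' / β), ∀ y, ‖w s y‖ ≤ 1 := by
    intro s hs y
    rw [hwapp, norm_smul, Real.norm_of_nonneg hαpos.le, hα]
    have := hbd (β * s) (hmemI hs) (γ • y)
    calc G⁻¹ * ‖u (β * s) (γ • y)‖ ≤ G⁻¹ * G := by gcongr
      _ = 1 := inv_mul_cancel₀ hG.ne'
  set K' : ℝ≥0∞ := ENNReal.ofReal |α| * (ENNReal.ofReal (γ ^ 3)⁻¹) ^ (1 / 2 : ℝ) * K with hK'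
  have hK'top : K' ≠ ∞ := by
    refine ENNReal.mul_ne_top (ENNReal.mul_ne_top ENNReal.ofReal_ne_top ?_) hK
    exact ENNReal.rpow_ne_top_of_nonneg (by norm_num) ENNReal.ofReal_ne_top
  have hL2' : ∀ s ∈ Icc 0 (T' / β), eLpNorm (w s) 2 volume ≤ K' := by
    intro s hs
    have h1 : w s = fun y => α • u (β * s) ((0 : EuclideanSpace ℝ (Fin 3)) + γ • y) := by
      funext y; rw [hwapp, zero_add]
    rw [h1]
    refine (eLpNorm_two_smul_comp_affine_le α hγpos 0).trans ?_
    rw [hK']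
    gcongr
    exact hL2 (β * s) (hmemI hs)
  have hB0' : ∀ y, ‖w 0 y‖ ≤ 1 / 2 := by
    intro y
    rw [hwapp, mul_zero, norm_smul, Real.norm_of_nonneg hαpos.le, hα]
    calc G⁻¹ * ‖u 0 (γ • y)‖ ≤ G⁻¹ * (G / 2) := mul_le_mul_of_nonneg_left (hB0 _) hαpos.le
      _ = 1 / 2 := by field_simp
  -- the rescaled time and window
  have htβ : t / β ∈ Ioo 0 (T' / β) := ⟨div_pos ht.1 hβpos, div_lt_div_of_pos_right ht.2 hβpos⟩
  have hwin : t / β ≤ ε := by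
    rw [div_le_iff₀ hβpos, hβ]
    refine htε.trans (le_of_eq ?_)
    field_simp
  have key := hunit hcl' hT'β hT'βT hbd' hK'top hL2' hB0' (t / β) htβ hwin (γ⁻¹ • x)
  -- undo the scaling
  rw [hwapp, mul_div_cancel₀ _ hβpos.ne', smul_smul, mul_inv_cancel₀ hγpos.ne', one_smul, norm_smul,
    Real.norm_of_nonneg hαpos.le] at key
  have htβ' : t / β = G ^ 2 * t / ν := by rw [hβ]; field_simp
  have hinv : 1 / (t / β) = ν / (G ^ 2 * t) := by rw [htβ', one_div_div]
  rw [hinv, htβ'] at key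
  -- `G⁻¹ ‖u t x‖ ≤ 1/2 + C √(G²t/ν)/√log` ⇒ multiply by `G`
  have hmul := mul_le_mul_of_nonneg_left key hG.le
  rw [hα, ← mul_assoc, mul_inv_cancel₀ hG.ne', one_mul] at hmul
  refine hmul.trans (le_of_eq ?_)
  ring

/-- **Log-suppressed overshoot of the speed above its initial maximum (data class of the crux).**
Absolute `C ≥ 0`, `ε > 0` such that every classical solution of the unforced Navier–Stokes system
on `ℝ³ × [0,T)` (`ν, T > 0`) that is Leray–Hopf from a rapidly decaying datum with
`‖u(0,·)‖ ≤ B₀` (`B₀ > 0`) satisfies, for all `x` and all `t ∈ (0, T)` with `t ≤ ε ν/B₀²`: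

  `‖u(t, x)‖ ≤ B₀ + C B₀ √(B₀² t/ν) / √(log (ν/(4 B₀² t)))`

(speed `≤ 2B₀` in the early window, `levelSetModeration_earlyWindow`; `G = 2B₀` in the scale
invariant form). The generic overshoot `≲ B₀√(B₀²t/ν)` (p163867) is thus never attained: the
`L^∞` norm leaves its initial value slower than `√t` by `√log(1/t)`. [folklore] -/
theorem levelSetModeration_overshoot_log :
    ∃ C ε : ℝ, 0 ≤ C ∧ 0 < ε ∧ ∀ (ν T : ℝ) (u : ℝ → EuclideanSpace ℝ (Fin 3) → EuclideanSpace ℝ (Fin 3)) (p : ℝ → EuclideanSpace ℝ (Fin 3) → ℝ), 0 < ν → 0 < T → Literature.Analysis.FluidPDE.IsClassicalNSSolutionOn (Set.Ico 0 T) ν 0 u p → Literature.Analysis.FluidPDE.IsLerayHopfOn T ν 0 (u 0) u → Literature.Analysis.FluidPDE.HasRapidSpatialDecay (u 0) → ∀ B₀ : ℝ, 0 < B₀ → (∀ x, ‖u 0 x‖ ≤ B₀) → ∀ t ∈ Set.Ioo 0 T, t ≤ ε * ν / B₀ ^ 2 → ∀ x, ‖u t x‖ ≤ B₀ + C * B₀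 * Real.sqrt (B₀ ^ 2 * t / ν) / Real.sqrt (Real.log (ν / (4 * B₀ ^ 2 * t))) := by
  obtain ⟨c₀, hc₀, hW⟩ := levelSetModeration_earlyWindow
  obtain ⟨C, ε, hC0, hε, hG⟩ := levelSetModeration_overshoot_log_of_speed_le
  refine ⟨4 * C, min (c₀ / 2) (ε / 4), by positivity, lt_min (by positivity) (by positivity), ?_⟩
  intro ν T u p hν hT hcl hLH hdec B₀ hB₀ hbd0 t ht htε x
  have ht0 : 0 < t := ht.1
  -- the horizon `T' = (t + T₁)/2`, `T₁ = min T (c₀ν/B₀²)`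
  set T₁ : ℝ := min T (c₀ * ν / B₀ ^ 2) with hT₁
  have htc₀ : t < c₀ * ν / B₀ ^ 2 := by
    have h1 : t ≤ c₀ / 2 * ν / B₀ ^ 2 := htε.trans
      (div_le_div_of_nonneg_right (mul_le_mul_of_nonneg_right (min_le_left _ _) hν.le)
        (by positivity))
    have h2 : c₀ / 2 * ν / B₀ ^ 2 < c₀ * ν / B₀ ^ 2 :=
      div_lt_div_of_pos_right (by nlinarith) (by positivity)
    exact h1.trans_lt h2
  have htT₁ : t < T₁ := lt_min ht.2 htc₀
  set T' : ℝ := (t + T₁) / 2 with hT'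
  have htT' : t < T' := by rw [hT']; linarith
  have hT'T₁ : T' < T₁ := by rw [hT']; linarith
  have hT'pos : 0 < T' := ht.1.trans htT'
  have hT'T : T' < T := hT'T₁.trans_le (min_le_left _ _)
  have hT'c : T' < c₀ * ν / B₀ ^ 2 := hT'T₁.trans_le (min_le_right _ _)
  have hbd : ∀ s ∈ Icc 0 T', ∀ y, ‖u s y‖ ≤ 2 * B₀ := fun s hs y =>
    (hW ν T u p hν hT hcl hLH hdec B₀ hB₀ hbd0 s ⟨hs.1, hs.2.trans_lt hT'T⟩
      (hs.2.trans_lt hT'c)).1 y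
  set KK : ℝ≥0∞ := (ENNReal.ofReal (∫ x, ‖u 0 x‖ ^ 2)) ^ (1 / 2 : ℝ) with hKK
  have hKKtop : KK ≠ ⊤ := ENNReal.rpow_ne_top_of_nonneg (by norm_num) ENNReal.ofReal_ne_top
  have hL2 : ∀ s ∈ Icc 0 T', eLpNorm (u s) 2 volume ≤ KK := by
    intro s hs
    have h := lintegral_enorm_sq_le_of_lerayHopf hLH hν.le ⟨hs.1, hs.2.trans hT'T.le⟩
    rw [eLpNorm_eq_lintegral_rpow_enorm_toReal (by norm_num) (by norm_num), ENNReal.toReal_ofNat,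
      hKK]
    refine ENNReal.rpow_le_rpow ?_ (by norm_num)
    refine le_trans (le_of_eq ?_) h
    exact lintegral_congr fun x => by rw [ENNReal.rpow_two]
  have hbd0' : ∀ y, ‖u 0 y‖ ≤ 2 * B₀ / 2 := fun y => (hbd0 y).trans (le_of_eq (by ring))
  have htw : t ≤ ε * ν / (2 * B₀) ^ 2 := by
    have h1 : t ≤ ε / 4 * ν / B₀ ^ 2 := htε.trans
      (div_le_div_of_nonneg_right (mul_le_mul_of_nonneg_right (min_le_right _ _) hν.le)
        (by positivity))
    refine h1.trans (le_of_eq ?_)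
    field_simp
    ring
  have key := hG hν (by positivity : (0 : ℝ) < 2 * B₀) hcl hT'pos hT'T hbd hKKtop hL2 hbd0'
    t ⟨ht.1, htT'⟩ htw x
  -- rewrite `(2B₀)² t/ν = 4 (B₀² t/ν)` and `ν/((2B₀)² t) = ν/(4B₀²t)`
  have h4 : (2 * B₀) ^ 2 * t / ν = 2 ^ 2 * (B₀ ^ 2 * t / ν) := by ring
  have hsq : Real.sqrt ((2 * B₀) ^ 2 * t / ν) = 2 * Real.sqrt (B₀ ^ 2 * t / ν) := by
    rw [h4, Real.sqrt_mul (by norm_num), Real.sqrt_sq (by norm_num)]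
  have hlog : ν / ((2 * B₀) ^ 2 * t) = ν / (4 * B₀ ^ 2 * t) := by ring
  rw [hsq, hlog] at key
  refine key.trans (le_of_eq ?_)
  ring

end Summit.NavierStokesRegularity.NavierStokesRegularity.Theorems

end
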